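import Summits.CriticalPhenomena.PercolationContinuityZ3.Theorems.FK.UniquenessInfiniteClusterFK
import Summits.CriticalPhenomena.PercolationContinuityZ3.Theorems.FK.ThetaIdentification
import HarnessLib

/-!
# FK-continuity transplant, FO-08 (leaf): Grimmett 2006, Thm. (5.99) and the (5.32) lower bound
# in the tree's `θ⁰/θ¹` notation

Cell `fk-continuity` (bschramm), row FO-08; support file for the FK-continuity transplant
(`--supports stmt-CriticalPhenomena-4575`); builds on p205010 (kernel theorem, internal audit signed;
external expert review pending).

`UniquenessInfiniteClusterFK.lean` states uniqueness of the infinite cluster and its consequences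
for a box limit `P = φ^b_{p,q}` with `θ^b` written as `P.real (percolatesAt 0)`; FO-07
(`ThetaIdentification.lean`, `IsBoxLimit.real_percolatesAt_eq_thetaFree/…Wired`) identifies this
with the tree's `thetaFree d p q` (Grimmett's `θ⁰(p,q)`) and `thetaWired d p q` (`θ¹(p,q)`). This
leaf file only rewrites along that identification (with the DLR sandwich hypothesis
`hG : FKGibbs d p q P` of the main file):

* Grimmett 2006, Thm. (5.99) verbatim: `φ^b_{p,q}(I = 1) = 1` whenever `θ^b(p,q) > 0`
  (`IsBoxLimit.measure_exactlyOneInfCluster_eq_one_of_thetaFree_pos` / `…_of_thetaWired_pos`),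
  and a.s. no infinite cluster when `θ^b(p,q) = 0`;
* the (5.32) lower bound `θ^b(p,q)² ≤ φ^b_{p,q}(x ↔ y)` (`IsBoxLimit.thetaFree_sq_le_real_openConn` /
  `…thetaWired_sq_le_real_openConn`);
* (the canonical limits `rcLimit d b p q`: `UniquenessInfiniteClusterFKCanonical.lean`).

## References

* G. Grimmett, *The Random-Cluster Model*, Springer 2006, (5.1), Thm. (5.99) p. 122, proof of
  (5.32) p. 107. [Grimmett2006]
-/

noncomputable section

open MeasureTheory Set Filter
open scoped ENNReal Topology

namespace Summit.CriticalPhenomena.PercolationContinuityZ3.Theorems.FK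

open Literature.Probability.Percolation Literature.Probability.LatticeModels
open Literature.Barriers.CriticalPhenomena (thetaWired)

variable {d : ℕ} {p q : ℝ} {P : Measure (BondConfig (Site d))}

/-! ### Free boundary condition: `θ⁰(p,q) = thetaFree d p q` -/

/-- **Grimmett 2006, Thm. (5.99), `b = 0`**: `φ⁰_{p,q}(I = 1) = 1` whenever `θ⁰(p,q) > 0`
(`0 ≤ p ≤ 1`, `q ≥ 1`, any box limit `P` of the free measures). [cite: Grimmett2006, Thm. (5.99) p. 122] -/
theorem IsBoxLimit.measure_exactlyOneInfCluster_eq_one_of_thetaFree_pos (hP : IsBoxLimit d false p q P) (hG : FKGibbs d p q P)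
    (hp : p ∈ Set.Icc (0 : ℝ) 1) (hq : 1 ≤ q) (hθ : 0 < thetaFree d p q) :
    P (exactlyOneInfCluster (Site d)) = 1 :=
  hP.measure_exactlyOneInfCluster_eq_one hG hp hq (by rwa [hP.real_percolatesAt_eq_thetaFree hp hq])

/-- `φ⁰_{p,q}(I = 1) = 1 ↔ θ⁰(p,q) > 0`. [cite: Grimmett2006, Thm. (5.99) p. 122] -/
theorem IsBoxLimit.measure_exactlyOneInfCluster_eq_one_iff_thetaFree_pos
    (hP : IsBoxLimit d false p q P) (hG : FKGibbs d p q P) (hp : p ∈ Set.Icc (0 : ℝ) 1) (hq : 1 ≤ q) :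
    P (exactlyOneInfCluster (Site d)) = 1 ↔ 0 < thetaFree d p q := by
  rw [hP.measure_exactlyOneInfCluster_eq_one_iff hG hp hq, hP.real_percolatesAt_eq_thetaFree hp hq]

/-- `θ⁰(p,q) = 0` forces `φ⁰_{p,q}`-a.s. no infinite cluster. [cite: Grimmett2006, Thm. (5.99) p. 122] -/
theorem IsBoxLimit.ae_numInfiniteClusters_eq_zero_of_thetaFree_eq_zero (hP : IsBoxLimit d false p q P) (hG : FKGibbs d p q P)
    (hp : p ∈ Set.Icc (0 : ℝ) 1) (hq : 1 ≤ q) (hθ : thetaFree d p q = 0) :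
    ∀ᵐ ω ∂P, numInfiniteClusters ω = 0 := by
  haveI := hP.isProbabilityMeasure
  refine hP.ae_numInfiniteClusters_eq_zero hG hp hq ?_
  rw [← measureReal_eq_zero_iff, hP.real_percolatesAt_eq_thetaFree hp hq, hθ]

/-- `θ⁰(p,q) > 0` forces `φ⁰_{p,q}`-a.s. exactly one infinite cluster. [cite: Grimmett2006, Thm. (5.99) p. 122] -/
theorem IsBoxLimit.ae_numInfiniteClusters_eq_one_of_thetaFree_pos (hP : IsBoxLimit d false p q P) (hG : FKGibbs d p q P)
    (hp : p ∈ Set.Icc (0 : ℝ) 1) (hq : 1 ≤ q) (hθ : 0 < thetaFree d p q) :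
    ∀ᵐ ω ∂P, numInfiniteClusters ω = 1 :=
  hP.ae_numInfiniteClusters_eq_one hG hp hq (by rwa [hP.real_percolatesAt_eq_thetaFree hp hq])

/-- **`θ⁰(p,q)² ≤ φ⁰_{p,q}(x ↔ y)`** for all `x, y` (Grimmett 2006, proof of (5.32): positive
association and uniqueness). [cite: Grimmett2006, proof of Thm. (5.17), eq. (5.32), p. 107] -/
theorem IsBoxLimit.thetaFree_sq_le_real_openConn (hP : IsBoxLimit d false p q P) (hG : FKGibbs d p q P)
    (hp : p ∈ Set.Icc (0 : ℝ) 1) (hq : 1 ≤ q) (x y : Site d) :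
    thetaFree d p q ^ 2 ≤ P.real (openConn x y) := by
  rw [← hP.real_percolatesAt_eq_thetaFree hp hq]
  exact hP.sq_real_percolatesAt_le_real_openConn hG hp hq x y

/-! ### Wired boundary condition: `θ¹(p,q) = thetaWired d p q` -/

/-- **Grimmett 2006, Thm. (5.99), `b = 1`**: `φ¹_{p,q}(I = 1) = 1` whenever `θ¹(p,q) > 0`.
[cite: Grimmett2006, Thm. (5.99) p. 122] -/
theorem IsBoxLimit.measure_exactlyOneInfCluster_eq_one_of_thetaWired_pos (hP : IsBoxLimit d true p q P) (hG : FKGibbs d p q P)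
    (hp : p ∈ Set.Icc (0 : ℝ) 1) (hq : 1 ≤ q) (hθ : 0 < thetaWired d p q) :
    P (exactlyOneInfCluster (Site d)) = 1 :=
  hP.measure_exactlyOneInfCluster_eq_one hG hp hq (by rwa [hP.real_percolatesAt_eq_thetaWired hp hq])

/-- `φ¹_{p,q}(I = 1) = 1 ↔ θ¹(p,q) > 0`. [cite: Grimmett2006, Thm. (5.99) p. 122] -/
theorem IsBoxLimit.measure_exactlyOneInfCluster_eq_one_iff_thetaWired_pos
    (hP : IsBoxLimit d true p q P) (hG : FKGibbs d p q P) (hp : p ∈ Set.Icc (0 : ℝ) 1) (hq : 1 ≤ q) :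
    P (exactlyOneInfCluster (Site d)) = 1 ↔ 0 < thetaWired d p q := by
  rw [hP.measure_exactlyOneInfCluster_eq_one_iff hG hp hq, hP.real_percolatesAt_eq_thetaWired hp hq]

/-- `θ¹(p,q) = 0` forces `φ¹_{p,q}`-a.s. no infinite cluster. [cite: Grimmett2006, Thm. (5.99) p. 122] -/
theorem IsBoxLimit.ae_numInfiniteClusters_eq_zero_of_thetaWired_eq_zero (hP : IsBoxLimit d true p q P) (hG : FKGibbs d p q P)
    (hp : p ∈ Set.Icc (0 : ℝ) 1) (hq : 1 ≤ q) (hθ : thetaWired d p q = 0) :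
    ∀ᵐ ω ∂P, numInfiniteClusters ω = 0 := by
  haveI := hP.isProbabilityMeasure
  refine hP.ae_numInfiniteClusters_eq_zero hG hp hq ?_
  rw [← measureReal_eq_zero_iff, hP.real_percolatesAt_eq_thetaWired hp hq, hθ]

/-- `θ¹(p,q) > 0` forces `φ¹_{p,q}`-a.s. exactly one infinite cluster. [cite: Grimmett2006, Thm. (5.99) p. 122] -/
theorem IsBoxLimit.ae_numInfiniteClusters_eq_one_of_thetaWired_pos (hP : IsBoxLimit d true p q P) (hG : FKGibbs d p q P)
    (hp : p ∈ Set.Icc (0 : ℝ) 1) (hq : 1 ≤ q) (hθ : 0 < thetaWired d p q) :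
    ∀ᵐ ω ∂P, numInfiniteClusters ω = 1 :=
  hP.ae_numInfiniteClusters_eq_one hG hp hq (by rwa [hP.real_percolatesAt_eq_thetaWired hp hq])

/-- **`θ¹(p,q)² ≤ φ¹_{p,q}(x ↔ y)`** for all `x, y`. [cite: Grimmett2006, proof of Thm. (5.17), eq. (5.32), p. 107] -/
theorem IsBoxLimit.thetaWired_sq_le_real_openConn (hP : IsBoxLimit d true p q P) (hG : FKGibbs d p q P)
    (hp : p ∈ Set.Icc (0 : ℝ) 1) (hq : 1 ≤ q) (x y : Site d) :
    thetaWired d p q ^ 2 ≤ P.real (openConn x y) := by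
  rw [← hP.real_percolatesAt_eq_thetaWired hp hq]
  exact hP.sq_real_percolatesAt_le_real_openConn hG hp hq x y

end Summit.CriticalPhenomena.PercolationContinuityZ3.Theorems.FK

end
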